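import Mathlib
import Literature.Analysis.FluidPDE.SelfSimilarEulerProfile
import Literature.Analysis.FluidPDE.AxisymmetricEuler
import HarnessLib

/-!
# R52 instruments: PRESSURE GRADIENT AT A SLOW POINT and THE AXIS ODE
# (nsreg-p2 `r52/Instruments52.lean` 664f5ed72eaf1125, `NsregP2.R52.gradient_pressure_at_slow_point` (proof by nsreg-p2 g41, landed
# verbatim) and `NsregP2.R52.AxisODE γ` VERBATIM; seat ns-sfl-p1 g8, `--supports stmt-NavierStokesRegularity-19832 --as helper`)

For a self-similar Euler profile `(γ, c, U, P)` (`IsSelfSimilarEulerProfile`: `(1−γ)U + DU[γ(y−c) + U] + ∇P = 0`, `div U = 0`):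
* `gradient_pressure_at_slow_point` — at a slow point `y₀` of the transport field (`W(y₀) = γ(y₀ − c) + U(y₀) = 0`) the profile equation
  collapses to `∇P(y₀) = (1−γ)γ·(y₀ − c)`; `gradient_pressure_add_potential_at_slow_point` — equivalently `∇(P + ½γ(γ−1)‖· − c‖²)(y₀) = 0`;
* ★ `axisODE (γ)` — `NsregP2.R52.AxisODE γ`: if `U` is tangent to the `x₂`-axis along the open segment `σ ∈ (s₁, s₂)` (`U(σ e_z) = u(σ) e_z`),
  then the axial component of the profile equation (centre `0`) there reads `(1−γ)u(σ) + (γσ + u(σ))·u′(σ) + ∂_z P(σ e_z) = 0`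
  (chain rule along `τ ↦ τ e_z`; `u` inherits differentiability on the open segment from `(U(τ e_z))₂`).

HONEST FRAMING: class-free pointwise facts about hypothetical profiles / straight axes (instruments for ROUND-52's inflow side); nothing
about the crux E (19832 OPEN) or NS regularity is proved here. [cite: ConstantinIgnatovaVicol2026Putative, §3 eq. (3.3)] [nsreg-p2 R52 instruments]
-/

noncomputable section

set_option linter.dupNamespace false

open MeasureTheory Set Filter Topology Metric Function
open scoped RealInnerProductSpace Topology

namespace Summit.NavierStokesRegularity.NavierStokesRegularity.Theorems.PowerGaugeEulerLiouville

open Literature.Analysis Literature.Analysis.FluidPDE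

namespace ClassicalProfile

/-! ## Pressure gradient at a slow point -/

/-- **Pressure gradient at a slow point** (exact): `W(y₀) = γ(y₀ − c) + U(y₀) = 0 ⇒ ∇P(y₀) = (1−γ)γ(y₀ − c)` — the profile equation
CIV (3.3) evaluated at a zero of the transport field (proof: nsreg-p2 g41, `r52/Instruments52.lean`, verbatim).
[cite: ConstantinIgnatovaVicol2026Putative, §3 eq. (3.3)] -/
theorem gradient_pressure_at_slow_point {γ : ℝ} {c : EuclideanSpace ℝ (Fin 3)}
    {U : EuclideanSpace ℝ (Fin 3) → EuclideanSpace ℝ (Fin 3)} {P : EuclideanSpace ℝ (Fin 3) → ℝ}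
    (h : IsSelfSimilarEulerProfile γ c U P) {y₀ : EuclideanSpace ℝ (Fin 3)} (hW : γ • (y₀ - c) + U y₀ = 0) :
    gradient P y₀ = ((1 - γ) * γ) • (y₀ - c) := by
  have e := h.profile_eq y₀
  rw [hW, map_zero, add_zero] at e
  have hU : U y₀ = -(γ • (y₀ - c)) := by
    rw [eq_neg_iff_add_eq_zero, add_comm]; exact hW
  rw [hU, smul_neg, smul_smul] at e
  rw [← sub_eq_zero, ← e]
  abel

/-- The slow point is a critical point of the pressure-plus-potential part of the self-similar Bernoulli function:
`∇P(y₀) + γ(γ−1)(y₀ − c) = 0`, i.e. `∇(P + ½γ(γ−1)‖· − c‖²)(y₀) = 0` (the kinetic part `½‖W‖²` is critical at `W = 0` trivially).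
(proof: nsreg-p2 g41, verbatim) [cite: ConstantinIgnatovaVicol2026Putative, §3.4.3 eq. (3.30)] -/
theorem gradient_pressure_add_potential_at_slow_point {γ : ℝ} {c : EuclideanSpace ℝ (Fin 3)}
    {U : EuclideanSpace ℝ (Fin 3) → EuclideanSpace ℝ (Fin 3)} {P : EuclideanSpace ℝ (Fin 3) → ℝ}
    (h : IsSelfSimilarEulerProfile γ c U P) {y₀ : EuclideanSpace ℝ (Fin 3)} (hW : γ • (y₀ - c) + U y₀ = 0) :
    gradient P y₀ + (γ * (γ - 1)) • (y₀ - c) = 0 := by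
  rw [gradient_pressure_at_slow_point h hW, ← add_smul]
  ring_nf
  simp

/-! ## The axis ODE -/

/-- `e_z` has third coordinate `1`. [folklore] -/
theorem eZ_apply_two : (eZ : EuclideanSpace ℝ (Fin 3)) 2 = 1 := by
  simp [eZ]

/-- The axial line `τ ↦ τ e_z` has velocity `e_z`. [folklore] -/
theorem hasDerivAt_smul_eZ (σ : ℝ) : HasDerivAt (fun τ : ℝ => τ • (eZ : EuclideanSpace ℝ (Fin 3))) eZ σ := by
  simpa using (hasDerivAt_id σ).smul_const (eZ : EuclideanSpace ℝ (Fin 3))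

/-- **THE AXIS ODE** (`NsregP2.R52.AxisODE γ` VERBATIM; nsreg-p2 ROUND-51 §3(b) / R52 instrument 2): if a self-similar profile `(γ, 0, U, P)`
is tangent to the `x₂`-axis along the open segment `σ ∈ (s₁, s₂)`, `U(σ e_z) = u(σ) e_z`, then
`(1−γ)u(σ) + (γσ + u(σ))·u′(σ) + (∇P(σ e_z))₂ = 0` there.  Proof: the profile equation at `σ e_z` reads
`(1−γ)U + DU[(γσ + u(σ)) e_z] + ∇P = 0`; `DU(σ e_z)[e_z] = d/dτ U(τ e_z)|_σ` (chain rule), whose third component is `u′(σ)` because `u`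
agrees with `τ ↦ (U(τ e_z))₂` on a neighbourhood of `σ`; take the third component. [cite: ConstantinIgnatovaVicol2026Putative, §3 eq. (3.3)] -/
theorem axisODE (γ : ℝ) :
    ∀ (U : EuclideanSpace ℝ (Fin 3) → EuclideanSpace ℝ (Fin 3)) (P : EuclideanSpace ℝ (Fin 3) → ℝ) (u : ℝ → ℝ) (s₁ s₂ : ℝ),
      IsSelfSimilarEulerProfile γ 0 U P →
      (∀ σ ∈ Ioo s₁ s₂, U (σ • eZ) = u σ • eZ) →
        ∀ σ ∈ Ioo s₁ s₂, (1 - γ) * u σ + (γ * σ + u σ) * deriv u σ + (gradient P (σ • eZ)) 2 = 0 := by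
  intro U P u s₁ s₂ hprof hax σ hσ
  -- the derivative of `U` along the axis
  have hUd : HasFDerivAt U (fderiv ℝ U (σ • eZ)) (σ • eZ) :=
    ((hprof.contDiff_velocity.differentiable (by norm_num)) _).hasFDerivAt
  have hline : HasDerivAt (fun τ : ℝ => U (τ • eZ)) (fderiv ℝ U (σ • eZ) eZ) σ :=
    hUd.comp_hasDerivAt σ (hasDerivAt_smul_eZ σ)
  -- its third component is `u′(σ)`
  have hcomp : HasDerivAt (fun τ : ℝ => (U (τ • eZ)) 2) ((fderiv ℝ U (σ • eZ) eZ) 2) σ :=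
    ((EuclideanSpace.proj (2 : Fin 3)).hasFDerivAt.comp_hasDerivAt σ hline :)
  have hnhds : ∀ᶠ τ in 𝓝 σ, (fun τ : ℝ => (U (τ • eZ)) 2) τ = u τ := by
    filter_upwards [Ioo_mem_nhds hσ.1 hσ.2] with τ hτ
    simp only [hax τ hτ, PiLp.smul_apply, smul_eq_mul, eZ_apply_two, mul_one]
  have hu : HasDerivAt u ((fderiv ℝ U (σ • eZ) eZ) 2) σ := hcomp.congr_of_eventuallyEq (hnhds.mono fun τ h => h.symm)
  -- the third component of the profile equation at `σ e_z`
  have e := hprof.profile_eq (σ • eZ)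
  have hW : γ • (σ • eZ - 0) + U (σ • eZ) = (γ * σ + u σ) • (eZ : EuclideanSpace ℝ (Fin 3)) := by
    rw [sub_zero, hax σ hσ, smul_smul, add_smul]
  rw [hW, map_smul, hax σ hσ] at e
  have e2 := congrArg (fun v : EuclideanSpace ℝ (Fin 3) => v 2) e
  simp only [PiLp.add_apply, PiLp.smul_apply, smul_eq_mul, eZ_apply_two, mul_one, PiLp.zero_apply] at e2
  rw [hu.deriv]
  linarith [e2]

end ClassicalProfile

end Summit.NavierStokesRegularity.NavierStokesRegularity.Theorems.PowerGaugeEulerLiouville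

end
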